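import Mathlib.Analysis.SpecialFunctions.Trigonometric.Deriv
import Literature.Analysis.FluidPDE.NSCoriolis
import HarnessLib

/-!
# Poincaré (inertial) waves: the Fourier symbol of the Coriolis operator and its dispersion
# relation `ξ_k = k₃/|k|`

Analysis/FluidPDE proof file (theorems only; no definitions, no named facts), sibling of
`NSCoriolis.lean`, supporting the named fact
`Literature.Analysis.FluidPDE.bmn1999_rotating_ns_global_regularity` (Babin–Mahalov–Nicolaenko,
Indiana Univ. Math. J. 48 (1999), Thm. 1.1). It formalises the linear algebra of BMN 1999, §2,
eqs. (2.1)–(2.8) — the **Poincaré propagator** — mode by mode.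

For a divergence-free field `U = ∑ₖ Uₖ e^{iǩ·x}` the amplitudes are transversal, `ǩ · Uₖ = 0`, the
Leray projection acts on the mode `k` as the orthogonal projection `P_k w = w − (⟪k, w⟫/|k|²) k`
onto `k^⊥`, the curl as `iǩ ×` ("the matrix `iRₙ` is the Fourier transform of the curl operator",
(2.6)), and the Coriolis operator `PJP`, `JU = e₃ × U` ((2.3): "`J` is the rotation matrix"), has
the symbol `v ↦ P_k (e₃ × v)` on `k^⊥`. Everything depends on the direction of `ǩ` only, so we
write `k` for `ǩ` (for unit periods `ǩ = 2πk`).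

* `cross_e₃_eq` — `e₃ × v = (−v₂, v₁, 0)` (BMN: "`JU = e₃ × U = (−U₂, U₁, 0)`").
* `norm_sq_smul_cross_e₃_sub_inner_smul` — **the symbol of the Coriolis operator on transversal
  amplitudes is a multiple of the curl symbol**: for `⟪k, v⟫ = 0`,
  `|k|² (e₃ × v) − ⟪k, e₃ × v⟫ k = k₃ (k × v)`, i.e. `P_k(e₃ × v) = (k₃/|k|²) k × v`
  (`cross_e₃_sub_proj_eq`, `k ≠ 0`); with `(k × ·)² = −|k|²` on `k^⊥`
  (`cross_self_cross_of_inner_eq_zero`; `‖k × v‖ = |k|‖v‖`, `norm_cross_of_inner_eq_zero`)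
  the symbol squares to `−(k₃/|k|)² = −ξ_k²`: its eigenvalues are `±iξ_k`, `ξ_k = k₃/|k|` —
  BMN (2.5), the **dispersion relation of inertial waves**.
* `hasDerivAt_poincareWave`, `inner_poincareWave_eq_zero`, `norm_poincareWave_eq` — **Poincaré
  waves**: for `k ≠ 0`, `⟪k, v₀⟫ = 0` and any `Ω`, the explicit mode
  `W(t) = cos(ξ_k Ω t) v₀ − sin(ξ_k Ω t) (k/|k|) × v₀` solves the linear Poincaré problem
  `W' + Ω P_k(e₃ × W) = 0` (BMN (2.1) `∂ₜΦ + ΩPJPΦ = 0` on the mode `k`; (2.6), (2.8):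
  `Φ(t) = E(−Ωt)Φ(0)`, `Eₙ(Ωt) = cos(ξₙΩt) I + sin(ξₙΩt) Rₙ/|ň|`), stays transversal and keeps its
  norm ("`E(−Ωt)` … preserves all Sobolev norms", p. 1140) — the fast oscillations with
  frequencies `Ωξ_k` that the van der Pol transformation (2.9) removes and whose three-wave
  resonances `±ξ_k ± ξ_m ± ξ_n = 0` (1.7) define the limit equations.

Real amplitudes suffice: the symbol is real, so real and imaginary parts of a complex amplitude
evolve independently by the same law.

## Mathlib / tree search

Mathlib: `crossProduct` on `Fin 3 → R` with `cross_apply`; trigonometric derivatives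
(`HasDerivAt.cos/sin`). Tree: `cross`, `crossCLM` on `EuclideanSpace ℝ (Fin 3)`
(`VectorCalculus`), `e₃`, `coriolisForce` (`NSCoriolis`); the general cross-product identities
(BAC–CAB `cross_cross_right` in `BiotSavartCurlPair`, Lagrange `Tao2016.norm_cross_sq` in
`TaoAveragedNondegeneracy`, `inner_fin_three` in `Algebra/EuclideanLattices`) live in unrelated
layers and are not imported; the transversal special cases needed here are checked in
coordinates. No Poincaré/inertial-wave material in the tree (searched `Poincare wave`,
`inertial`, `dispersion` with `Coriolis`: none).

## References

* A. Babin, A. Mahalov, B. Nicolaenko, *Global regularity of 3D rotating Navier–Stokes equations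
  for resonant domains*, Indiana Univ. Math. J. 48 (1999) 1133–1176, §2, eqs. (2.1)–(2.9), and
  (1.7). [BabinMahalovNicolaenko1999]
* H. Poincaré, *Sur la précession des corps déformables*, Bull. Astronomique 27 (1910) 321–356;
  S. L. Sobolev, Izv. Akad. Nauk SSSR Ser. Mat. 18 (1954) 3–50 (the linear problem; cited as
  [38], [41] in BMN 1999).
-/

noncomputable section

open scoped InnerProductSpace RealInnerProductSpace

namespace Literature.Analysis.FluidPDE

/-! ### Coordinates -/

/-- The coordinates of `e₃ = (0, 0, 1)`. [folklore] -/
theorem e₃_apply (i : Fin 3) : e₃ i = if i = 2 then 1 else 0 := by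
  simp [e₃]

/-- **The rotation matrix `J`**: `e₃ × v = (−v₂, v₁, 0)` (BMN 1999, (2.3): "`JU = e₃ × U =
(−U₂, U₁, 0)`"; indices `0, 1, 2` in Lean). [cite: BabinMahalovNicolaenko1999, eq. (2.3)] -/
theorem cross_e₃_eq (v : EuclideanSpace ℝ (Fin 3)) :
    cross e₃ v = WithLp.toLp 2 ![-v 1, v 0, 0] := by
  ext i
  fin_cases i <;>
  simp [cross, cross_apply, e₃_apply]

/-- The coordinates of `k × v`. [folklore] -/
theorem cross_apply_fin_three (k v : EuclideanSpace ℝ (Fin 3)) :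
    cross k v 0 = k 1 * v 2 - k 2 * v 1 ∧ cross k v 1 = k 2 * v 0 - k 0 * v 2 ∧
      cross k v 2 = k 0 * v 1 - k 1 * v 0 := by
  refine ⟨?_, ?_, ?_⟩ <;> simp [cross, cross_apply]

/-! ### The curl symbol `k ×` on the transversal plane `k^⊥` -/

/-- **The curl symbol squares to `−|k|²` on the transversal plane**: for `⟪k, v⟫ = 0`,
`k × (k × v) = −|k|² v` (BMN 1999, (2.7): the eigenvalues of `iň ×` on `ň^⊥` are `±|ň|`).
[cite: BabinMahalovNicolaenko1999, eq. (2.7)] -/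
theorem cross_self_cross_of_inner_eq_zero {k v : EuclideanSpace ℝ (Fin 3)} (hkv : ⟪k, v⟫ = 0) :
    cross k (cross k v) = -(‖k‖ ^ 2 • v) := by
  simp only [PiLp.inner_apply, RCLike.inner_apply, conj_trivial, Fin.sum_univ_three] at hkv
  rw [← real_inner_self_eq_norm_sq k]
  simp only [PiLp.inner_apply, RCLike.inner_apply, conj_trivial, Fin.sum_univ_three]
  obtain ⟨h0, h1, h2⟩ := cross_apply_fin_three k v
  obtain ⟨g0, g1, g2⟩ := cross_apply_fin_three k (cross k v)
  ext i
  fin_cases i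
  · simp only [Fin.zero_eta, PiLp.neg_apply, PiLp.smul_apply, smul_eq_mul, g0, h1, h2]
    linear_combination (k 0) * hkv
  · simp only [Fin.mk_one, PiLp.neg_apply, PiLp.smul_apply, smul_eq_mul, g1, h0, h2]
    linear_combination (k 1) * hkv
  · simp only [Fin.reduceFinMk, PiLp.neg_apply, PiLp.smul_apply, smul_eq_mul, g2, h0, h1]
    linear_combination (k 2) * hkv

/-- For transversal `v`, `|k × v| ² = |k|² |v|²`: `k ×` is `|k|` times an isometry of `k^⊥`.
[folklore] -/
theorem norm_cross_sq_of_inner_eq_zero {k v : EuclideanSpace ℝ (Fin 3)} (hkv : ⟪k, v⟫ = 0) :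
    ‖cross k v‖ ^ 2 = ‖k‖ ^ 2 * ‖v‖ ^ 2 := by
  simp only [PiLp.inner_apply, RCLike.inner_apply, conj_trivial, Fin.sum_univ_three] at hkv
  rw [← real_inner_self_eq_norm_sq (cross k v), ← real_inner_self_eq_norm_sq k,
    ← real_inner_self_eq_norm_sq v]
  obtain ⟨h0, h1, h2⟩ := cross_apply_fin_three k v
  simp only [PiLp.inner_apply, RCLike.inner_apply, conj_trivial, Fin.sum_univ_three, h0, h1, h2]
  linear_combination (-(k 0 * v 0 + k 1 * v 1 + k 2 * v 2)) * hkv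

/-! ### The symbol of the Coriolis operator `PJP` -/

/-- **The Fourier symbol of the Coriolis operator on divergence-free amplitudes.** For a
transversal amplitude, `⟪k, v⟫ = 0`:
`|k|² (e₃ × v) − ⟪k, e₃ × v⟫ k = k₃ (k × v)`,
i.e. the projection of `Jv = e₃ × v` onto `k^⊥` (the mode-`k` action of the Leray projector `P`)
is `(k₃/|k|²) k × v` — the operator `PJP` of BMN 1999, (2.1)/(2.3), acts on the mode `k` as
`ξ_k` times the unit curl symbol `(k/|k|) ×`, `ξ_k = k₃/|k|` ((2.5)–(2.6)). Division-free form,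
valid also for `k = 0`. Proof: a polynomial identity modulo the transversality relation, checked
coordinatewise. [cite: BabinMahalovNicolaenko1999, eqs. (2.5)–(2.6)] -/
theorem norm_sq_smul_cross_e₃_sub_inner_smul {k v : EuclideanSpace ℝ (Fin 3)}
    (hkv : ⟪k, v⟫ = 0) :
    ‖k‖ ^ 2 • cross e₃ v - ⟪k, cross e₃ v⟫ • k = k 2 • cross k v := by
  simp only [PiLp.inner_apply, RCLike.inner_apply, conj_trivial, Fin.sum_univ_three] at hkv
  rw [← real_inner_self_eq_norm_sq k, cross_e₃_eq]
  simp only [PiLp.inner_apply, RCLike.inner_apply, conj_trivial, Fin.sum_univ_three]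
  obtain ⟨h0, h1, h2⟩ := cross_apply_fin_three k v
  ext i
  fin_cases i
  · simp only [Fin.zero_eta, PiLp.sub_apply, PiLp.smul_apply, smul_eq_mul, Matrix.cons_val_zero, Matrix.cons_val_one, Matrix.cons_val_two, Matrix.tail_cons,
      Matrix.head_cons, h0]
    linear_combination (-(k 1)) * hkv
  · simp only [Fin.mk_one, PiLp.sub_apply, PiLp.smul_apply, smul_eq_mul, Matrix.cons_val_zero, Matrix.cons_val_one, Matrix.cons_val_two, Matrix.tail_cons,
      Matrix.head_cons, h1]
    linear_combination (k 0) * hkv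
  · simp only [Fin.reduceFinMk, PiLp.sub_apply, PiLp.smul_apply, smul_eq_mul, Matrix.cons_val_zero, Matrix.cons_val_one, Matrix.cons_val_two, Matrix.tail_cons,
      Matrix.head_cons, h2]
    ring

/-- The same in projected form for `k ≠ 0`: `P_k (e₃ × v) = e₃ × v − (⟪k, e₃ × v⟫/|k|²) k =
(k₃/|k|²) k × v` for transversal `v`. [cite: BabinMahalovNicolaenko1999, eqs. (2.5)–(2.6)] -/
theorem cross_e₃_sub_proj_eq {k v : EuclideanSpace ℝ (Fin 3)} (hk : k ≠ 0) (hkv : ⟪k, v⟫ = 0) :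
    cross e₃ v - (⟪k, cross e₃ v⟫ / ‖k‖ ^ 2) • k = (k 2 / ‖k‖ ^ 2) • cross k v := by
  have hk2 : ‖k‖ ^ 2 ≠ 0 := pow_ne_zero 2 (norm_ne_zero_iff.2 hk)
  have h := norm_sq_smul_cross_e₃_sub_inner_smul hkv
  have h' := congrArg (fun w => (‖k‖ ^ 2)⁻¹ • w) h
  simp only [smul_sub, smul_smul, inv_mul_cancel₀ hk2, one_smul] at h'
  rw [div_eq_inv_mul, div_eq_inv_mul]
  exact h'

/-- **The Coriolis symbol is skew on `k^⊥`**: `⟪(k₃/|k|²) k × v, v⟫ = 0` — mode by mode the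
Coriolis operator does no work (cf. `inner_coriolisForce_self`). [folklore] -/
theorem inner_coriolisSymbol_self (k v : EuclideanSpace ℝ (Fin 3)) :
    ⟪(k 2 / ‖k‖ ^ 2) • cross k v, v⟫ = 0 := by
  obtain ⟨h0, h1, h2⟩ := cross_apply_fin_three k v
  rw [real_inner_smul_left]
  simp only [PiLp.inner_apply, RCLike.inner_apply, conj_trivial, Fin.sum_univ_three, h0, h1, h2]
  ring

/-! ### Poincaré waves -/

/-- **A rotation in an orthogonal frame preserves the norm**: if `⟪v, u⟫ = 0` and `‖u‖ = ‖v‖`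
then `‖cos θ · v − sin θ · u‖ = ‖v‖`. [folklore] -/
theorem norm_cos_smul_sub_sin_smul {E : Type*} [NormedAddCommGroup E] [InnerProductSpace ℝ E]
    {v u : E} (huv : ⟪v, u⟫ = 0) (hn : ‖u‖ = ‖v‖) (θ : ℝ) :
    ‖Real.cos θ • v - Real.sin θ • u‖ = ‖v‖ := by
  have huv' : ⟪u, v⟫ = 0 := by rw [real_inner_comm]; exact huv
  have hsq : ‖Real.cos θ • v - Real.sin θ • u‖ ^ 2 = ‖v‖ ^ 2 := by
    rw [← real_inner_self_eq_norm_sq (Real.cos θ • v - Real.sin θ • u)]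
    simp only [inner_sub_left, inner_sub_right, real_inner_smul_left, real_inner_smul_right]
    rw [real_inner_self_eq_norm_sq, real_inner_self_eq_norm_sq, huv, huv', hn]
    linear_combination ‖v‖ ^ 2 * Real.cos_sq_add_sin_sq θ
  have h := congrArg Real.sqrt hsq
  rwa [Real.sqrt_sq (norm_nonneg _), Real.sqrt_sq (norm_nonneg _)] at h

section PoincareWave

variable {k v₀ : EuclideanSpace ℝ (Fin 3)} (Ω : ℝ)

/-- **Poincaré waves stay transversal**: for `⟪k, v₀⟫ = 0` the mode
`W = cos θ · v₀ − (sin θ/|k|) · k × v₀` satisfies `⟪k, W⟫ = 0` (any phase `θ`). [folklore] -/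
theorem inner_poincareWave_eq_zero (hkv : ⟪k, v₀⟫ = 0) (θ : ℝ) :
    ⟪k, Real.cos θ • v₀ - (Real.sin θ / ‖k‖) • cross k v₀⟫ = 0 := by
  have hkc : ⟪k, cross k v₀⟫ = 0 := by
    obtain ⟨h0, h1, h2⟩ := cross_apply_fin_three k v₀
    simp only [PiLp.inner_apply, RCLike.inner_apply, conj_trivial, Fin.sum_univ_three, h0, h1, h2]
    ring
  rw [inner_sub_right, real_inner_smul_right, real_inner_smul_right, hkv, hkc]
  ring

/-- For transversal `v₀`, `‖k × v₀‖ = ‖k‖ ‖v₀‖`. [folklore] -/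
theorem norm_cross_of_inner_eq_zero (hkv : ⟪k, v₀⟫ = 0) : ‖cross k v₀‖ = ‖k‖ * ‖v₀‖ := by
  have h := congrArg Real.sqrt (norm_cross_sq_of_inner_eq_zero hkv)
  rwa [← mul_pow, Real.sqrt_sq (norm_nonneg _),
    Real.sqrt_sq (mul_nonneg (norm_nonneg _) (norm_nonneg _))] at h

/-- **Poincaré waves keep their amplitude**: for `k ≠ 0` and `⟪k, v₀⟫ = 0`,
`‖cos θ · v₀ − (sin θ/|k|) · k × v₀‖ = ‖v₀‖` (BMN 1999, p. 1140: "`E(−Ωt) = exp(−ΩPJPt)`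
preserves all Sobolev norms": mode by mode the propagator is a rotation of the plane `k^⊥`, in
the orthogonal frame `v₀`, `(k/|k|) × v₀` of equal lengths). (For `k = 0` the statement fails:
the wave degenerates to `cos θ · v₀`.) [cite: BabinMahalovNicolaenko1999, §2 p. 1140] -/
theorem norm_poincareWave_eq (hk : k ≠ 0) (hkv : ⟪k, v₀⟫ = 0) (θ : ℝ) :
    ‖Real.cos θ • v₀ - (Real.sin θ / ‖k‖) • cross k v₀‖ = ‖v₀‖ := by
  have hkn : ‖k‖ ≠ 0 := norm_ne_zero_iff.2 hk
  have hu : ‖‖k‖⁻¹ • cross k v₀‖ = ‖v₀‖ := by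
    rw [norm_smul, norm_inv, norm_norm, norm_cross_of_inner_eq_zero hkv,
      inv_mul_cancel_left₀ hkn]
  have horth : ⟪v₀, ‖k‖⁻¹ • cross k v₀⟫ = 0 := by
    obtain ⟨h0, h1, h2⟩ := cross_apply_fin_three k v₀
    rw [real_inner_smul_right]
    simp only [PiLp.inner_apply, RCLike.inner_apply, conj_trivial, Fin.sum_univ_three, h0, h1, h2]
    ring
  rw [div_eq_mul_inv, mul_smul]
  exact norm_cos_smul_sub_sin_smul horth hu θ

/-- **Poincaré waves solve the linear rotating problem** (BMN 1999, (2.1), (2.6), (2.8)): for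
`k ≠ 0` and a transversal amplitude `⟪k, v₀⟫ = 0`, the mode
`W(t) = cos(ξ_k Ω t) v₀ − (sin(ξ_k Ω t)/|k|) k × v₀`, `ξ_k = k₃/|k|`,
has derivative `W'(t) = −Ω (k₃/|k|²) k × W(t)`, which by
`cross_e₃_sub_proj_eq` and `inner_poincareWave_eq_zero` is `−Ω P_k(e₃ × W(t))`: the Fourier
mode `k` of `∂ₜΦ + ΩPJPΦ = 0`. Its time frequency is `Ωξ_k` — the dispersion relation (2.5) of
inertial waves. [cite: BabinMahalovNicolaenko1999, eqs. (2.1), (2.5)–(2.8)] -/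
theorem hasDerivAt_poincareWave (hk : k ≠ 0) (hkv : ⟪k, v₀⟫ = 0) (t : ℝ) :
    HasDerivAt
      (fun s => Real.cos (k 2 / ‖k‖ * Ω * s) • v₀ -
        (Real.sin (k 2 / ‖k‖ * Ω * s) / ‖k‖) • cross k v₀)
      (-(Ω • ((k 2 / ‖k‖ ^ 2) •
        cross k (Real.cos (k 2 / ‖k‖ * Ω * t) • v₀ -
          (Real.sin (k 2 / ‖k‖ * Ω * t) / ‖k‖) • cross k v₀)))) t := by
  have hkn : ‖k‖ ≠ 0 := norm_ne_zero_iff.2 hk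
  set a : ℝ := k 2 / ‖k‖ * Ω with ha
  have h1 : HasDerivAt (fun s => Real.cos (a * s)) (-Real.sin (a * t) * a) t := by
    simpa using ((hasDerivAt_id t).const_mul a).cos
  have h2 : HasDerivAt (fun s => Real.sin (a * s) / ‖k‖) (Real.cos (a * t) * a / ‖k‖) t := by
    simpa using (((hasDerivAt_id t).const_mul a).sin).div_const ‖k‖
  refine ((h1.smul_const v₀).sub (h2.smul_const (cross k v₀))).congr_deriv ?_
  -- expand `k × W(t)` on the frame `v₀`, `k × v₀` of `k^⊥`
  rw [show cross k (Real.cos (a * t) • v₀ - (Real.sin (a * t) / ‖k‖) • cross k v₀) =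
      Real.cos (a * t) • cross k v₀ - (Real.sin (a * t) / ‖k‖) • cross k (cross k v₀) by
    simp only [← crossCLM_apply, map_sub, map_smul],
    cross_self_cross_of_inner_eq_zero hkv]
  -- compare coordinates
  ext i
  simp only [ha, PiLp.sub_apply, PiLp.smul_apply, PiLp.neg_apply, smul_eq_mul]
  field_simp
  ring

/-- The same derivative written with the Coriolis symbol `P_k(e₃ × ·)`:
`W'(t) = −Ω (e₃ × W(t) − (⟪k, e₃ × W(t)⟫/|k|²) k)` — the mode-`k` form of BMN's linear
Poincaré problem (2.1), `∂ₜΦ + ΩPJPΦ = 0`. [cite: BabinMahalovNicolaenko1999, eq. (2.1)] -/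
theorem hasDerivAt_poincareWave' (hk : k ≠ 0) (hkv : ⟪k, v₀⟫ = 0) (t : ℝ) :
    HasDerivAt
      (fun s => Real.cos (k 2 / ‖k‖ * Ω * s) • v₀ -
        (Real.sin (k 2 / ‖k‖ * Ω * s) / ‖k‖) • cross k v₀)
      (-(Ω • (cross e₃ (Real.cos (k 2 / ‖k‖ * Ω * t) • v₀ -
            (Real.sin (k 2 / ‖k‖ * Ω * t) / ‖k‖) • cross k v₀) -
          (⟪k, cross e₃ (Real.cos (k 2 / ‖k‖ * Ω * t) • v₀ -
              (Real.sin (k 2 / ‖k‖ * Ω * t) / ‖k‖) • cross k v₀)⟫ / ‖k‖ ^ 2) • k))) t := by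
  rw [cross_e₃_sub_proj_eq hk (inner_poincareWave_eq_zero hkv _)]
  exact hasDerivAt_poincareWave Ω hk hkv t

end PoincareWave

/-! ### Barotropic modes: geostrophic balance (BMN (2.10)) -/

/-- **Barotropic (vertically averaged) modes feel no Coriolis force after Leray projection**:
for a horizontal wave vector `k` (`k₃ = 0`), `k ≠ 0`, and a transversal amplitude `⟪k, v⟫ = 0`,
`P_k(e₃ × v) = e₃ × v − (⟪k, e₃ × v⟫/|k|²) k = 0` — the Coriolis force of a two-dimensional
divergence-free field is a gradient (geostrophic balance). Mode by mode this is BMN 1999,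
(2.5)/(2.10): "`ξₙ = 0` for `n₃ = 0` and … `E(−Ωt) = exp(−ΩPJPt)` reduces to the identity
operator on any barotropic (vertically averaged) field". [cite: BabinMahalovNicolaenko1999, eq. (2.10)] -/
theorem cross_e₃_sub_proj_eq_zero_of_apply_two_eq_zero {k v : EuclideanSpace ℝ (Fin 3)}
    (hk : k ≠ 0) (hkv : ⟪k, v⟫ = 0) (hk2 : k 2 = 0) :
    cross e₃ v - (⟪k, cross e₃ v⟫ / ‖k‖ ^ 2) • k = 0 := by
  rw [cross_e₃_sub_proj_eq hk hkv, hk2, zero_div, zero_smul]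

/-- **The Poincaré propagator is the identity on barotropic modes**: for `k₃ = 0` the Poincaré
wave `cos(ξ_k Ω t) v₀ − (sin(ξ_k Ω t)/|k|) k × v₀` is the constant `v₀` (`ξ_k = k₃/|k| = 0`;
BMN 1999, (2.10): `Ū = E(−Ωt)ū = ū`). [cite: BabinMahalovNicolaenko1999, eq. (2.10)] -/
theorem poincareWave_eq_of_apply_two_eq_zero {k v₀ : EuclideanSpace ℝ (Fin 3)} (Ω : ℝ)
    (hk2 : k 2 = 0) (t : ℝ) :
    Real.cos (k 2 / ‖k‖ * Ω * t) • v₀ - (Real.sin (k 2 / ‖k‖ * Ω * t) / ‖k‖) • cross k v₀ = v₀ := by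
  rw [hk2, zero_div, zero_mul, zero_mul, Real.cos_zero, Real.sin_zero, one_smul, zero_div,
    zero_smul, sub_zero]

end Literature.Analysis.FluidPDE

end
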